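import Literature.Geometry.Lorentzian.CausalityPushUp
import Literature.Geometry.Lorentzian.RedShiftedHorizon
import Literature.Geometry.Lorentzian.RadiatedEnergy
import HarnessLib

/-!
# `∂I⁻(S) = ∂J⁻(S)`: the two event-horizon notions of a Cauchy development agree

Two definitions of the future event horizon of a region of a Cauchy development entered the tree
on 2026-08-15: `CauchyDevelopment.eventHorizonOf 𝒟 U = ∂I⁻(U) ∩ J⁺(ι X)`
(`RedShiftedHorizon.lean`, frontier of the *chronological* past) and
`CauchyDevelopment.futureEventHorizonOf 𝒟 O = ∂J⁻(O) ∩ J⁺(ι X)` (`RadiatedEnergy.lean`,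
frontier of the *causal* past; stated for `3`-dimensional data). This file proves that they
coincide (`CauchyDevelopment.eventHorizonOf_eq_futureEventHorizonOf`, in dimension `3 + 1` where
both are defined), through the general fact that on
a manifold without boundary the chronological and the causal past of any set have the same
closure, the same interior and hence the same frontier:

* `LorentzianMetric.closure_causalPast_eq` — `cl J⁻(S) = cl I⁻(S)` (`I⁻ ⊆ J⁻ ⊆ cl I⁻`,
  O'Neill 1983, Ch. 14, Lemma 14.6 (2));
* `LorentzianMetric.interior_causalPast_eq` — `int J⁻(S) = I⁻(S)` (`I⁻` is open, and a point
  with a neighbourhood inside `J⁻(S)` has a chronological successor in `J⁻(S)`, whence it lies in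
  `I⁻(S)` by push-up, O'Neill 1983, Ch. 14, Cor. 14.1);
* `LorentzianMetric.frontier_causalPast_eq` — `∂J⁻(S) = ∂I⁻(S)` (O'Neill 1983, Ch. 14, p. 403:
  `I⁻(A) = I⁻(J⁻A)`, Lemma 14.6; Hawking–Ellis 1973, §6.3, Prop. 6.3.1: `İ⁺(S) = J̇⁺(S)` is the
  achronal boundary).

Everything is proved from the boundaryless causality theory of
`Literature.Geometry.Lorentzian.CausalityPushUp` / `….CausalityOpennessProofs` (openness of
`I^±`, `J^± ⊆ cl I^±`, push-up), for `Cⁿ` metrics with `1 ≤ n` on finite-dimensional manifolds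
without boundary; the `CauchyDevelopment` corollary is unconditional (spacetime carriers are
modelled on `𝓡 (n + 1)`, boundaryless). Kept in its own module so that neither definition file
imports the other's cone.

## References

* B. O'Neill, *Semi-Riemannian geometry with applications to relativity*, Academic Press 1983,
  Ch. 14, Cor. 14.1 (p. 402), p. 403, Lemma 14.6 (p. 404) (key `ONeillSemiRiemannian1983`).
* S. W. Hawking, G. F. R. Ellis, *The large scale structure of space-time*, CUP 1973, §6.3,
  Prop. 6.3.1 (key `HawkingEllis1973`).
-/

noncomputable section

open Set
open scoped Manifold ContDiff Topology

universe u

namespace Literature.Geometry.Lorentzian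

namespace LorentzianMetric

variable {E : Type*} [NormedAddCommGroup E] [NormedSpace ℝ E] {H : Type*} [TopologicalSpace H]
  {I : ModelWithCorners ℝ E H} {n : ℕ∞ω} {M : Type*} [TopologicalSpace M] [ChartedSpace H M]
  [IsManifold I ∞ M] [BoundarylessManifold I M] [FiniteDimensional ℝ E]
  (g : LorentzianMetric I n M) (τ : TimeOrientation g)

/-- **`cl J⁻(S) = cl I⁻(S)`** on a manifold without boundary (`Cⁿ` metric, `1 ≤ n`, finite
dimension): `I⁻(S) ⊆ J⁻(S) ⊆ cl I⁻(S)`, the second inclusion being O'Neill's Lemma 14.6 (2) in its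
past form (`causalFuture_subset_closure_chronologicalFuture_of_boundaryless` for the reversed time
orientation). O'Neill 1983, Ch. 14, Lemma 14.6 (2) (p. 404) with p. 402 (time duality).
[cite: ONeillSemiRiemannian1983, Ch. 14, Lemma 14.6 (2) (p. 404)] -/
theorem closure_causalPast_eq (hn : 1 ≤ n) (S : Set M) :
    closure (g.causalPast τ S) = closure (g.chronologicalPast τ S) :=
  Subset.antisymm
    (closure_minimal (causalFuture_subset_closure_chronologicalFuture_of_boundaryless
      (g := g) (τ := τ.reverse) hn S) isClosed_closure)
    (closure_mono (chronologicalFuture_subset_causalFuture g τ.reverse S))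

/-- **`int J⁻(S) = I⁻(S)`** on a manifold without boundary (`Cⁿ` metric, `1 ≤ n`, finite
dimension). `⊇`: `I⁻(S)` is open (`isOpen_chronologicalPast_of_boundaryless`) and contained in
`J⁻(S)`. `⊆`: if a neighbourhood `V` of `r` lies in `J⁻(S)`, pick `q ∈ V` with `r ≪ q`
(`r ∈ cl I⁺(r)`, `mem_closure_chronologicalFuture_self`); then `r ≪ q ≤ u` for some `u ∈ S`, so
`r ≪ u` by push-up (O'Neill's Cor. 14.1, `mem_chronologicalFuture_of_mem_causalFuture` for the
reversed time orientation). O'Neill 1983, Ch. 14, Cor. 14.1 (p. 402) and p. 403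
(`I⁻(A) = I⁻(J⁻A)`). [cite: ONeillSemiRiemannian1983, Ch. 14, Cor. 14.1 (p. 402) and p. 403] -/
theorem interior_causalPast_eq (hn : 1 ≤ n) (S : Set M) :
    interior (g.causalPast τ S) = g.chronologicalPast τ S := by
  refine Subset.antisymm ?_
    (interior_maximal (chronologicalFuture_subset_causalFuture g τ.reverse S)
      (isOpen_chronologicalPast_of_boundaryless g τ S))
  intro r hr
  -- a chronological successor `q` of `r` inside the open set `interior J⁻(S) ⊆ J⁻(S)`
  have hcl : r ∈ closure (g.chronologicalFuture τ {r}) :=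
    g.mem_closure_chronologicalFuture_self τ BoundarylessManifold.isInteriorPoint
  obtain ⟨q, hqV, hqr⟩ := mem_closure_iff_nhds.mp hcl _ (isOpen_interior.mem_nhds hr)
  -- `q ≤ u` for some `u ∈ S` (in the past direction: `q ∈ J⁻(S) = J⁺_{reverse}(S)`)
  have hqJ : q ∈ g.causalFuture τ.reverse S := interior_subset hqV
  rw [causalFuture_eq_biUnion] at hqJ
  simp only [mem_iUnion, exists_prop] at hqJ
  obtain ⟨u, huS, hqu⟩ := hqJ
  -- `r ≪ q` read in the reversed orientation: `r ∈ I⁺_{reverse}(q)`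
  have hrq : r ∈ g.chronologicalFuture τ.reverse {q} :=
    mem_chronologicalPast_of_mem_chronologicalFuture hqr
  -- push-up in the reversed orientation: `r ∈ I⁺_{reverse}(u) = I⁻(u) ⊆ I⁻(S)`
  have hru : r ∈ g.chronologicalFuture τ.reverse {u} :=
    mem_chronologicalFuture_of_mem_causalFuture (τ := τ.reverse) hn hqu hrq
  exact chronologicalFuture_mono (singleton_subset_iff.mpr huS) hru

/-- **`∂J⁻(S) = ∂I⁻(S)`**: on a manifold without boundary the causal and the chronological past
of any set have the same frontier (same closure, `closure_causalPast_eq`; same interior,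
`interior_causalPast_eq`, `I⁻(S)` being open). This common frontier is the achronal boundary
`İ⁻(S) = J̇⁻(S)` of Hawking–Ellis 1973, §6.3, Prop. 6.3.1; O'Neill 1983, Ch. 14, p. 403 and
Cor. 14.27. [cite: HawkingEllis1973, §6.3 Prop. 6.3.1] -/
theorem frontier_causalPast_eq (hn : 1 ≤ n) (S : Set M) :
    frontier (g.causalPast τ S) = frontier (g.chronologicalPast τ S) := by
  rw [frontier, frontier, g.closure_causalPast_eq τ hn S, g.interior_causalPast_eq τ hn S,
    (isOpen_chronologicalPast_of_boundaryless g τ S).interior_eq]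

end LorentzianMetric

namespace CauchyDevelopment

-- `futureEventHorizonOf` (`RadiatedEnergy.lean`) is stated for developments of `3`-dimensional data;
-- `eventHorizonOf` (`RedShiftedHorizon.lean`) for any dimension. The comparison lives in dimension `3 + 1`.
variable {X : Type u} [TopologicalSpace X] [ChartedSpace E3 X] [IsManifold (𝓡 3) ∞ X]
  [ConnectedSpace X] {D : InitialDataSet (𝓡 3) X}

/-- **The two event-horizon notions of a Cauchy development agree**:
`𝒟.eventHorizonOf U = ∂I⁻(U) ∩ J⁺(ι X)` (`RedShiftedHorizon.lean`) equals
`𝒟.futureEventHorizonOf U = ∂J⁻(U) ∩ J⁺(ι X)` (`RadiatedEnergy.lean`), unconditionally — the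
spacetime carrier is a manifold without boundary, on which `∂J⁻(U) = ∂I⁻(U)`
(`LorentzianMetric.frontier_causalPast_eq`). Hawking–Ellis 1973, §6.3, Prop. 6.3.1 and §9.2;
O'Neill 1983, Ch. 14, p. 403. [cite: HawkingEllis1973, §6.3 Prop. 6.3.1] -/
theorem eventHorizonOf_eq_futureEventHorizonOf (𝒟 : CauchyDevelopment D) (U : Set 𝒟.carrier) :
    𝒟.eventHorizonOf U = 𝒟.futureEventHorizonOf U := by
  have hn : (1 : ℕ∞ω) ≤ ∞ := by exact_mod_cast le_top
  rw [eventHorizonOf, futureEventHorizonOf,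
    𝒟.metric.frontier_causalPast_eq 𝒟.timeOrientation hn U]

/-- The red-shift predicate may equivalently be read on the `∂J⁻` form of the horizon: the late
horizons `𝒟.eventHorizonOf U ∩ {t ≥ t₁}` and `𝒟.futureEventHorizonOf U ∩ {t ≥ t₁}` are the same
set (`eventHorizonOf_eq_futureEventHorizonOf`). [folklore] -/
theorem hasEventuallyRedShiftedHorizon_iff_futureEventHorizonOf (𝒟 : CauchyDevelopment D)
    [𝒟.metric.HasLeviCivita] (U : Set 𝒟.carrier) (t : 𝒟.carrier → ℝ) :
    𝒟.HasEventuallyRedShiftedHorizon U t ↔ ∃ κ₀ : ℝ, 0 < κ₀ ∧ ∃ t₁ : ℝ,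
      𝒟.metric.HasSurfaceGravityGe 𝒟.timeOrientation
        (𝒟.futureEventHorizonOf U ∩ {p | t₁ ≤ t p}) t κ₀ := by
  rw [hasEventuallyRedShiftedHorizon_iff, eventHorizonOf_eq_futureEventHorizonOf]

end CauchyDevelopment

end Literature.Geometry.Lorentzian

end
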